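import Summits.HodgeConjecture.HodgeConjecture.Theorems.F0P2nBorelCharactersUnipotent
import HarnessLib

/-!
# J2, third currency: an `N`-INVARIANT, `T`-EQUIVARIANT functional (the raw output of a Jacquet-module computation) gives the
# non-zero intertwiner into `i_G(χ)` and, for an irreducible source, a constituent of `i_G(χ)`

Cell hodgecm-mathlib F0∕P2, crux `stmt-HodgeConjecture-24833` (`H413`), line `Cruxes/H413/Lines/F0_P2GR91NJacquet.lean`; sequel of
★ `F0P2nFrobeniusFunctional` (J2: equivariance with `δ_P^{1/2}` at `p`) and ★ `F0P2nBorelCharactersUnipotent` (J2b: `δ_B|_N = 1` for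
`U(3)(L⁺_v)`, equivariance with `χ (proj p) · δ^{1/2}(proj p)`).  Here the functional `ℓ` is given by the two conditions a Jacquet
module hands out — `ℓ (π n v) = ℓ v` (`n ∈ N`) and `ℓ (π m v) = χ(m) · δ_P^{1/2}(m) · ℓ v` (`m ∈ M`) — and `P = M N` converts them
into the `proj` form (`functional_proj_of_levi_unipotent`).  MODEL-FREE; theorems only.

* §1 generic parabolic triples: `functional_proj_of_levi_unipotent`; `exists_intertwiningMap_normalizedInd_character_of_functional_levi`.
* §2 the CM∕letter tokens (★ `Rogawski1990.Gqs L v`, ★ `cmPrincipalSeries L 3 v (cmXiTorusChar L v μ η₁ η₂)`): the intertwiner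
  head `exists_intertwiningMap_cmPrincipalSeries_xi_of_functional_levi` and, for an IRREDUCIBLE source, the constituent head
  `exists_isConstituentOf_cmPrincipalSeries_xi_of_functional_levi` (`∃ x₀ ∈ JH(i_G(χ_ξ)), x₀ = ⟦π⟧` — the first conjunct of
  ★ `GR91Lemma512NonsplitAsPrinted`'s conclusion with the witness named).

References: [BernsteinZelevinsky1977, 1.8, §2.3, Prop. 1.9 (b)]; [BernsteinZelevinsky1976, Prop. 2.28]; [Rogawski1990, §12.1–§12.2];
[GelbartRogawski1991, §5.1 Lem. 5.1.2].
-/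

set_option autoImplicit false
set_option linter.dupNamespace false

noncomputable section

open NumberField IsDedekindDomain

namespace Summit.HodgeConjecture.HodgeConjecture.Cruxes.H413.F0P2nJacquetFunctionalCurrency

open Literature.NumberTheory.Automorphic Literature.NumberTheory.Automorphic.UnitaryGroup

/-! ## §1 Generic parabolic triples `P = M N` -/

section Generic

variable {G V : Type*} [Group G] [AddCommGroup V] [Module ℂ V] (t : ParabolicTriple G)

/-- **`P = M N` converts the Jacquet-module currency into the `proj` currency**: if `ℓ` is `N`-invariant and `M`-equivariant
for a character `c`, then `ℓ (π p v) = c (proj p) · ℓ v` for every `p ∈ P` (`p = proj p · n`, `n = (proj p)⁻¹ p ∈ N`).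
[cite: BernsteinZelevinsky1977, 1.8] -/
theorem functional_proj_of_levi_unipotent (π : Representation ℂ G V) (ℓ : V →ₗ[ℂ] ℂ) (c : t.M →* ℂˣ)
    (hN : ∀ (n : G), n ∈ t.N → ∀ v : V, ℓ (π n v) = ℓ v) (hM : ∀ (m : t.M) (v : V), ℓ (π m v) = ((c m : ℂˣ) : ℂ) * ℓ v)
    (p : t.P) (v : V) : ℓ (π p v) = ((c (t.proj p) : ℂˣ) : ℂ) * ℓ v := by
  have hn : ((t.proj p : G))⁻¹ * (p : G) ∈ t.N := t.proj_inv_mul_mem p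
  calc ℓ (π p v) = ℓ (π ((t.proj p : G) * (((t.proj p : G))⁻¹ * (p : G))) v) := by rw [mul_inv_cancel_left]
    _ = ℓ (π (t.proj p : G) (π (((t.proj p : G))⁻¹ * (p : G)) v)) := by rw [map_mul, Module.End.mul_apply]
    _ = ((c (t.proj p) : ℂˣ) : ℂ) * ℓ (π (((t.proj p : G))⁻¹ * (p : G)) v) := hM _ _
    _ = ((c (t.proj p) : ℂˣ) : ℂ) * ℓ v := by rw [hN _ hn]

variable [TopologicalSpace G] [IsTopologicalGroup G] [LocallyCompactSpace t.P]

/-- **J2 in the Jacquet-module currency.**  `δ_P^{1/2}|_N = 1`, `π` smooth, `ℓ` an `N`-invariant functional with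
`ℓ (π m v) = χ(m) · δ_P^{1/2}(m) · ℓ v` on `M` and `ℓ v₀ ≠ 0`: there is a `G`-map `Φ : π → i_P^G χ` with `Φ v₀ ≠ 0` and
`(Φ v) g = ℓ (π g v)` (★ `F0P2nBorelCharactersUnipotent.exists_intertwiningMap_normalizedInd_character_of_functional_proj`).
[cite: BernsteinZelevinsky1976, Proposition 2.28] [cite: BernsteinZelevinsky1977, §2.3] -/
theorem exists_intertwiningMap_normalizedInd_character_of_functional_levi
    (hδ : ∀ (n : G) (hn : n ∈ t.N), rootDeltaChar t.P ⟨n, t.N_le hn⟩ = 1) (χ : t.M →* ℂˣ) (π : Representation ℂ G V)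
    (hπ : π.IsSmooth) (ℓ : V →ₗ[ℂ] ℂ) (hN : ∀ (n : G), n ∈ t.N → ∀ v : V, ℓ (π n v) = ℓ v)
    (hM : ∀ (m : t.M) (v : V), ℓ (π m v) = ((χ m : ℂˣ) : ℂ) * ((rootDeltaChar t.P ⟨(m : G), t.M_le m.2⟩ : ℂˣ) : ℂ) * ℓ v)
    (v₀ : V) (hv₀ : ℓ v₀ ≠ 0) :
    ∃ Φ : π.IntertwiningMap (Representation.normalizedInd t ((Representation.trivial ℂ t.M ℂ).twist χ)),
      Φ v₀ ≠ 0 ∧ ∀ (v : V) (g : G), (Φ v).toFun g = ℓ (π g v) := by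
  -- the `M`-character `m ↦ χ m · δ^{1/2}(m)`
  let c : t.M →* ℂˣ := χ * (rootDeltaChar t.P).comp (Subgroup.inclusion t.M_le)
  have hc : ∀ m : t.M, ((c m : ℂˣ) : ℂ) = ((χ m : ℂˣ) : ℂ) * ((rootDeltaChar t.P ⟨(m : G), t.M_le m.2⟩ : ℂˣ) : ℂ) := fun m => by
    rw [MonoidHom.mul_apply, Units.val_mul, MonoidHom.comp_apply]
    rfl
  refine F0P2nBorelCharactersUnipotent.exists_intertwiningMap_normalizedInd_character_of_functional_proj t hδ χ π hπ ℓ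
    (fun p v => ?_) v₀ hv₀
  rw [functional_proj_of_levi_unipotent t π ℓ c hN (fun m v => by rw [hM, hc]) p v, hc]

end Generic

/-! ## §2 The letter's tokens: `U(3)(L⁺_v) = Gqs L v`, `χ_ξ = cmXiTorusChar L v μ η₁ η₂` -/

section CM

variable (L : Type) [Field L] [NumberField L] [IsCMField L]

/-- **J2, Jacquet-module currency, letter tokens.**  A smooth `π` of ★ `Rogawski1990.Gqs L v` with a functional `ℓ`, `ℓ w₀ ≠ 0`,
invariant under `N(L⁺_v)` and transforming under the diagonal torus `T(L⁺_v)` by `χ_ξ · δ_B^{1/2}` (`χ_ξ` = ★ `cmXiTorusChar L v μ η₁ η₂`)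
has a `G`-map `Φ : π → i_G(χ_ξ)` = ★ `cmPrincipalSeries L 3 v (cmXiTorusChar L v μ η₁ η₂)` with `Φ w₀ ≠ 0`, `(Φ w) g = ℓ (π g w)`.
[cite: BernsteinZelevinsky1976, Proposition 2.28] [cite: Rogawski1990, §12.2 p. 174] -/
theorem exists_intertwiningMap_cmPrincipalSeries_xi_of_functional_levi (v : HeightOneSpectrum (𝓞 ↥(maximalRealSubfield L)))
    (μ : (LocalRing L v)ˣ →* ℂˣ) (η₁ η₂ : ↥(normOneUnits (conjLocal L (IsCMField.complexConj L) v)) →* ℂˣ)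
    {V : Type*} [AddCommGroup V] [Module ℂ V] (π : Representation ℂ (Literature.NumberTheory.Rogawski1990.Gqs L v) V)
    (hπ : π.IsSmooth) (ℓ : V →ₗ[ℂ] ℂ)
    (hN : ∀ n : Literature.NumberTheory.Rogawski1990.Gqs L v, n ∈ (cmBorelTriple L 3 v).N → ∀ w : V, ℓ (π n w) = ℓ w)
    (hM : haveI := locallyCompactSpace_cmBorelU L 3 v
      ∀ (m : ↥(cmBorelTriple L 3 v).M) (w : V),
        ℓ (π m.1 w) = ((cmXiTorusChar L v μ η₁ η₂ m : ℂˣ) : ℂ) *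
          ((rootDeltaChar (cmBorelTriple L 3 v).P ⟨(m : ↥(unitaryGroupOfForm _ _)), (cmBorelTriple L 3 v).M_le m.2⟩ : ℂˣ) : ℂ) * ℓ w)
    (w₀ : V) (hw₀ : ℓ w₀ ≠ 0) :
    ∃ Φ : π.IntertwiningMap (cmPrincipalSeries L 3 v (cmXiTorusChar L v μ η₁ η₂)),
      Φ w₀ ≠ 0 ∧ ∀ (w : V) (g : _), (Φ w).toFun g = ℓ (π g w) :=
  haveI := locallyCompactSpace_cmBorelU L 3 v
  exists_intertwiningMap_normalizedInd_character_of_functional_levi (cmBorelTriple L 3 v)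
    (F0P2nBorelCharactersUnipotent.rootDeltaChar_cmBorel_eq_one L v) (cmXiTorusChar L v μ η₁ η₂) π hπ ℓ hN hM w₀ hw₀

/-- **Constituent head, Jacquet-module currency.**  If moreover `π` (on `W : Type`) is IRREDUCIBLE, its class is a constituent of
`i_G(χ_ξ)`: `∃ x₀ : IrrClass (Gqs L v), x₀.IsConstituentOf (i_G(χ_ξ)) ∧ x₀ = ⟦π⟧` (Schur: ★ `F0P2nFrobeniusFunctional.isConstituentOf_mk_of_intertwiningMap_ne_zero`).
[cite: Rogawski1990, §12.2 p. 174] [cite: GelbartRogawski1991, §5.1 Lem. 5.1.2] -/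
theorem exists_isConstituentOf_cmPrincipalSeries_xi_of_functional_levi (v : HeightOneSpectrum (𝓞 ↥(maximalRealSubfield L)))
    (μ : (LocalRing L v)ˣ →* ℂˣ) (η₁ η₂ : ↥(normOneUnits (conjLocal L (IsCMField.complexConj L) v)) →* ℂˣ)
    {W : Type} [AddCommGroup W] [Module ℂ W] (π : Representation ℂ (Literature.NumberTheory.Rogawski1990.Gqs L v) W)
    (hirr : π.IsIrreducible) (hπ : π.IsSmooth) (ℓ : W →ₗ[ℂ] ℂ)
    (hN : ∀ n : Literature.NumberTheory.Rogawski1990.Gqs L v, n ∈ (cmBorelTriple L 3 v).N → ∀ w : W, ℓ (π n w) = ℓ w)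
    (hM : haveI := locallyCompactSpace_cmBorelU L 3 v
      ∀ (m : ↥(cmBorelTriple L 3 v).M) (w : W),
        ℓ (π m.1 w) = ((cmXiTorusChar L v μ η₁ η₂ m : ℂˣ) : ℂ) *
          ((rootDeltaChar (cmBorelTriple L 3 v).P ⟨(m : ↥(unitaryGroupOfForm _ _)), (cmBorelTriple L 3 v).M_le m.2⟩ : ℂˣ) : ℂ) * ℓ w)
    (w₀ : W) (hw₀ : ℓ w₀ ≠ 0) :
    ∃ x₀ : IrrClass (Literature.NumberTheory.Rogawski1990.Gqs L v),
      x₀.IsConstituentOf (cmPrincipalSeries L 3 v (cmXiTorusChar L v μ η₁ η₂)) ∧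
        x₀ = IrrClass.mk { V := W, ρ := π, isIrreducible := hirr, isSmooth := hπ } := by
  obtain ⟨Φ, hΦ, -⟩ := exists_intertwiningMap_cmPrincipalSeries_xi_of_functional_levi L v μ η₁ η₂ π hπ ℓ hN hM w₀ hw₀
  have hΦ0 : Φ ≠ 0 := fun h => hΦ (by rw [h]; rfl)
  exact ⟨_, F0P2nFrobeniusFunctional.isConstituentOf_mk_of_intertwiningMap_ne_zero hirr hπ Φ hΦ0, rfl⟩

end CM

end Summit.HodgeConjecture.HodgeConjecture.Cruxes.H413.F0P2nJacquetFunctionalCurrency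

end
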